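import Summits.BirchSwinnertonDyer.Rank1Residual.X1.MuLambdaAlgebra
import Summits.BirchSwinnertonDyer.Rank1Residual.X11b.CastellaErratumCongruenceLimit
import HarnessLib

/-!
# Keller–Yin §5 (`imc mult`, arXiv:2402.12781v2 Thm 5.1.3 = README "KY Thm 4") — the free-part step
# (v2 L1754) in the kernel: a counterexample to the inference, and the repaired congruence-limit
# closed by Iwasawa invariants (cell `bsd-eis`, seat `bsd-eis-ky`, memo `bsd-eis-ky-MEMO-2.md`)

HONEST FRAMING (cell `bsd-eis`, home `run/shared/lean/pub/bsd-eis/`; FULL-BSD rank-≤1 programme,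
rows B11 / A10-non-split, display atom (IMC) of `X2/RankOneLinks.lean`). Nothing about elliptic
curves, Selmer groups or `p`-adic `L`-functions is constructed or asserted here. This file is PURE
COMMUTATIVE ALGEBRA over the tree's Iwasawa algebra `Λ = ℤ_[p]⟦T⟧`, kernel-checking two sentences
of the seat memo `bsd-eis-ky-MEMO-2.md`:

* §1 (memo §2, G2) — the sentence of Keller–Yin v2 L1754 "since the μ-invariants are `0`,
  `λ(𝔛^S_f)` (resp. `λ(𝔛^S_{f_m})`) determines `𝔛^S_{f,free}/𝔭^m` (resp. `𝔛^S_{f_m,free}/𝔭^m`). Thus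
  there is an equality of ideals `(Fitt(𝔛^S_{f,free}), 𝔭^m) = (Fitt(𝔛^S_{f_m,free}), 𝔭^m)`" is a
  non-sequitur: `g₁ = T` and `g₂ = T − p` have `μ = 0`, `λ = 1`, the same reduction mod `p`, the
  cyclic modules `Λ/(gᵢ)` are `ℤ_p`-free of rank one with `Fitt₀ = (gᵢ)`, and yet
  `(g₁) + (p)² ≠ (g₂) + (p)²` (`span_X_sup_sq_ne_span_X_sub_C_sup_sq`) and `(g₁) ≠ (g₂)`.
* §2 (memo §4, S5–S8) — the REPAIRED limit argument: in the skeleton of [Ski16, §3.1] / Castella's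
  erratum p. 4 (tree `X11b.CongruenceLimit.isTorsion_and_charIdeal_eq_of_congruences`) the input
  "`Fitt₀(N_m) = (L_m)`" (which needs the member-side modules `N_m = 𝔛^S_{f_m}` to have NO finite
  submodule — false in general at an Eisenstein prime, Keller–Yin L259/L303) is WEAKENED to the
  one-sided `Fitt₀(N_m) ≤ (L_m)` (true for every torsion module with `char = (L_m)`), at the price
  of two inputs Keller–Yin DO prove (memo §3, Theorem D′): `μ(g) = μ(L) = 0` and `λ(g) ≤ λ(L)` for
  `char(M) = (g)`; plus `(p)^a·(g) ≤ Fitt₀(M)` (from the finite submodule of the FIXED module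
  `M = 𝔛^S_f`). Conclusion `char(M) = (g) = (L)` (`span_eq_span_of_forall_pow_mul_span_le_sup`,
  `charIdeal_eq_span_of_oneSided_congruences`). The one non-algebraic input this leaves — the
  lattice congruence `T_{f_m}/ϖ^m ≅ T_f/ϖ^m` behind the quotient isomorphisms `e` — is the memo's
  input (α), NOT in print for residually reducible `f`.

References: Keller–Yin arXiv:2402.12781v2 §5.1 (L1735–1770) [KellerYin2024, PRE];
C. Skinner, Pacific J. Math. 283 (2016) §3.1 [Skinner2016PacificMC]; F. Castella, erratum to CJM 6
(2018) = arXiv:2409.01360 Thm 3.1 [Castella2018Erratum]; Greenberg–Vatsal, Invent. Math. 142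
(2000) p. 4 [GreenbergVatsal2000]; Stacks 07ZA [StacksProject].
-/

set_option autoImplicit false

noncomputable section

open Literature.RingTheory.FittingIdeal Literature.NumberTheory.EllipticCurves
  Literature.NumberTheory.EllipticCurves.Module Summit.BirchSwinnertonDyer.Rank1Residual.X1.MuLambda
  Summit.BirchSwinnertonDyer.Rank1Residual.X11b.CongruenceLimit

namespace Summit.BirchSwinnertonDyer.Rank1Residual.X2.KellerYinFreePartGap

variable {p : ℕ} [Fact p.Prime]

/-! ## §1. The inference at Keller–Yin v2 L1754 fails: `T` versus `T − p` -/

/-- `(p : ℤ_[p])` reduces to `0` in the residue field. [folklore] -/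
theorem residue_p_eq_zero : IsLocalRing.residue ℤ_[p] (p : ℤ_[p]) = 0 := by
  rw [IsLocalRing.residue_eq_zero_iff, PadicInt.maximalIdeal_eq_span_p]
  exact Ideal.mem_span_singleton_self _

/-- `T` and `T − p` are congruent modulo `p`: same image in `𝔽_p⟦T⟧`. [folklore] -/
theorem red_X_sub_C_eq_red_X :
    red (p := p) (PowerSeries.X - PowerSeries.C (p : ℤ_[p])) = red (p := p) PowerSeries.X := by
  simp only [red, map_sub, PowerSeries.map_X, PowerSeries.map_C, residue_p_eq_zero, map_zero,
    sub_zero]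

/-- `red T = T ≠ 0`. [folklore] -/
theorem red_X_ne_zero : red (p := p) PowerSeries.X ≠ 0 := by
  rw [red, PowerSeries.map_X]
  exact PowerSeries.X_ne_zero

/-- `μ(T) = 0` and the `p`-free part of `T` is `T`. [folklore] -/
theorem mu_X_eq_zero_and_pfree_X :
    mu (p := p) PowerSeries.X = 0 ∧ pfree (p := p) PowerSeries.X = PowerSeries.X :=
  mu_eq_and_pfree_eq (a := 0) (g := PowerSeries.X) red_X_ne_zero (by simp)

/-- `μ(T − p) = 0` and the `p`-free part of `T − p` is itself. [folklore] -/
theorem mu_X_sub_C_eq_zero_and_pfree :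
    mu (p := p) (PowerSeries.X - PowerSeries.C (p : ℤ_[p])) = 0 ∧
      pfree (p := p) (PowerSeries.X - PowerSeries.C (p : ℤ_[p])) =
        PowerSeries.X - PowerSeries.C (p : ℤ_[p]) := by
  have h : red (p := p) (PowerSeries.X - PowerSeries.C (p : ℤ_[p])) ≠ 0 := by
    rw [red_X_sub_C_eq_red_X]; exact red_X_ne_zero
  exact mu_eq_and_pfree_eq (a := 0) h (by simp)

/-- `λ(T) = 1`. [folklore] -/
theorem lam_X : lam (p := p) PowerSeries.X = 1 := by
  rw [lam, mu_X_eq_zero_and_pfree_X.2, red, PowerSeries.map_X, PowerSeries.order_X]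
  rfl

/-- `λ(T − p) = 1`. [folklore] -/
theorem lam_X_sub_C : lam (p := p) (PowerSeries.X - PowerSeries.C (p : ℤ_[p])) = 1 := by
  rw [lam, mu_X_sub_C_eq_zero_and_pfree.2, red_X_sub_C_eq_red_X, red, PowerSeries.map_X,
    PowerSeries.order_X]
  rfl

/-- `T` and `T − p` have the same Iwasawa invariants: `μ = 0`, `λ = 1`. [folklore] -/
theorem mu_lam_agree :
    mu (p := p) PowerSeries.X = mu (p := p) (PowerSeries.X - PowerSeries.C (p : ℤ_[p])) ∧
      lam (p := p) PowerSeries.X = lam (p := p) (PowerSeries.X - PowerSeries.C (p : ℤ_[p])) := by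
  rw [mu_X_eq_zero_and_pfree_X.1, mu_X_sub_C_eq_zero_and_pfree.1, lam_X, lam_X_sub_C]
  exact ⟨rfl, rfl⟩

/-- The two cyclic modules are even congruent modulo `p` as Λ-modules:
`(T) + (p) = (T − p) + (p)` (so `Λ/(T, p) = Λ/(T − p, p)`), matching Keller–Yin's (c) "same
residual data". [folklore] -/
theorem span_X_sup_C_eq_span_X_sub_C_sup_C :
    Ideal.span {(PowerSeries.X : IwasawaAlgebra p)} ⊔ Ideal.span {PowerSeries.C (p : ℤ_[p])} =
      Ideal.span {PowerSeries.X - PowerSeries.C (p : ℤ_[p])} ⊔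
        Ideal.span {PowerSeries.C (p : ℤ_[p])} := by
  apply le_antisymm
  · refine sup_le ?_ le_sup_right
    rw [Ideal.span_singleton_le_iff_mem]
    have hx : (PowerSeries.X - PowerSeries.C (p : ℤ_[p])) + PowerSeries.C (p : ℤ_[p]) ∈
        Ideal.span {(PowerSeries.X - PowerSeries.C (p : ℤ_[p]) : IwasawaAlgebra p)} ⊔
          Ideal.span {PowerSeries.C (p : ℤ_[p])} :=
      Ideal.add_mem _ (Ideal.mem_sup_left (Ideal.mem_span_singleton_self _))
        (Ideal.mem_sup_right (Ideal.mem_span_singleton_self _))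
    rwa [sub_add_cancel] at hx
  · refine sup_le ?_ le_sup_right
    rw [Ideal.span_singleton_le_iff_mem]
    exact Ideal.sub_mem _ (Ideal.mem_sup_left (Ideal.mem_span_singleton_self _))
      (Ideal.mem_sup_right (Ideal.mem_span_singleton_self _))

/-- `p` does not lie in the ideal `(T − p, p²)` of `ℤ_[p]⟦T⟧`: comparing the coefficients of `T⁰` and
`T¹` in `p = a·(T − p) + b·p²` gives `a₀ = p b₀ − 1` and `a₀ = p(a₁ − p b₁)`, so `p ∣ 1`. [folklore] -/
theorem C_p_not_mem_span_X_sub_C_sup_sq :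
    (PowerSeries.C (p : ℤ_[p]) : IwasawaAlgebra p) ∉
      Ideal.span {PowerSeries.X - PowerSeries.C (p : ℤ_[p])} ⊔
        Ideal.span {PowerSeries.C (p : ℤ_[p])} ^ 2 := by
  intro hmem
  rw [Ideal.span_singleton_pow, Ideal.mem_span_singleton_sup] at hmem
  obtain ⟨a, c, hc, hac⟩ := hmem
  obtain ⟨b, rfl⟩ := Ideal.mem_span_singleton'.mp hc
  -- coefficient of `T⁰`
  have h0 := congrArg (PowerSeries.coeff 0) hac
  -- coefficient of `T¹`
  have h1 := congrArg (PowerSeries.coeff 1) hac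
  simp only [map_add, PowerSeries.coeff_zero_eq_constantCoeff, map_mul, map_sub,
    PowerSeries.constantCoeff_X, PowerSeries.constantCoeff_C, map_pow, zero_sub] at h0
  have hX1 : PowerSeries.coeff 1 (a * PowerSeries.X) = PowerSeries.coeff 0 a :=
    PowerSeries.coeff_succ_mul_X 0 a
  simp only [mul_sub, map_sub, map_add, hX1, ← map_pow, PowerSeries.coeff_mul_C,
    PowerSeries.coeff_C, one_ne_zero, if_false, PowerSeries.coeff_zero_eq_constantCoeff] at h1
  -- h0 : a₀ * (-p) + b₀ * p^2 = p ;  h1 : a₀ - a₁ * p + b₁ * p ^ 2 = 0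
  have hp : (p : ℤ_[p]) ≠ 0 := by exact_mod_cast (Fact.out : p.Prime).ne_zero
  have key : (p : ℤ_[p]) * (PowerSeries.constantCoeff b - PowerSeries.coeff 1 a +
      PowerSeries.coeff 1 b * p) = 1 := by
    have e0 : PowerSeries.constantCoeff a = PowerSeries.constantCoeff b * p - 1 := by
      have : (p : ℤ_[p]) * (PowerSeries.constantCoeff b * p - 1 - PowerSeries.constantCoeff a) =
          0 := by linear_combination h0
      rcases mul_eq_zero.mp this with h | h
      · exact absurd h hp
      · linear_combination -h
    linear_combination h1 - e0
  have hunit : IsUnit (p : ℤ_[p]) := IsUnit.of_mul_eq_one _ key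
  exact PadicInt.p_nonunit hunit

/-- **Keller–Yin v2 L1754 is a non-sequitur (memo §2, G2).** The ideals `(T) + (p)²` and
`(T − p) + (p)²` of `Λ = ℤ_[p]⟦T⟧` are different, although `T` and `T − p` have the same `μ` (`= 0`)
and `λ` (`= 1`) (`mu_lam_agree`) and are congruent mod `p` (`span_X_sup_C_eq_span_X_sub_C_sup_C`);
for the cyclic modules `Yᵢ = Λ/(gᵢ)` (no finite submodule, `Fitt₀(Yᵢ) = (gᵢ)`,
`fittingIdeal_zero_quotient`) this says `(Fitt(Y₁), p²) ≠ (Fitt(Y₂), p²)`: the invariants `(μ, λ)`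
do NOT determine `(Fitt(X_free), 𝔭^m)`. (Keller–Yin v2 L1754, this step only) [claim: KellerYin2024, status: disputed] -/
theorem span_X_sup_sq_ne_span_X_sub_C_sup_sq :
    Ideal.span {(PowerSeries.X : IwasawaAlgebra p)} ⊔ Ideal.span {PowerSeries.C (p : ℤ_[p])} ^ 2 ≠
      Ideal.span {PowerSeries.X - PowerSeries.C (p : ℤ_[p])} ⊔
        Ideal.span {PowerSeries.C (p : ℤ_[p])} ^ 2 := by
  intro heq
  apply C_p_not_mem_span_X_sub_C_sup_sq (p := p)
  have hX : (PowerSeries.X : IwasawaAlgebra p) ∈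
      Ideal.span {PowerSeries.X - PowerSeries.C (p : ℤ_[p])} ⊔
        Ideal.span {PowerSeries.C (p : ℤ_[p])} ^ 2 := by
    rw [← heq]; exact Ideal.mem_sup_left (Ideal.mem_span_singleton_self _)
  have hsub : (PowerSeries.X - PowerSeries.C (p : ℤ_[p]) : IwasawaAlgebra p) ∈
      Ideal.span {PowerSeries.X - PowerSeries.C (p : ℤ_[p])} ⊔
        Ideal.span {PowerSeries.C (p : ℤ_[p])} ^ 2 :=
    Ideal.mem_sup_left (Ideal.mem_span_singleton_self _)
  have hdiff := Ideal.sub_mem _ hX hsub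
  rwa [sub_sub_cancel] at hdiff

/-- The same two modules as `Λ`-modules with `Fitt₀` computed: `Fitt₀(Λ/(T)) + (p)² ≠
Fitt₀(Λ/(T − p)) + (p)²` — the literal shape of the disputed equality of Keller–Yin §5.1 for two
modules with equal `μ = 0`, equal `λ = 1` and `Fitt = char`. (Keller–Yin v2 L1754, this step only) [claim: KellerYin2024, status: disputed] -/
theorem fittingIdeal_quotient_sup_sq_ne :
    Module.fittingIdeal (IwasawaAlgebra p)
        (IwasawaAlgebra p ⧸ Ideal.span {(PowerSeries.X : IwasawaAlgebra p)}) 0 ⊔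
        Ideal.span {PowerSeries.C (p : ℤ_[p])} ^ 2 ≠
      Module.fittingIdeal (IwasawaAlgebra p)
        (IwasawaAlgebra p ⧸ Ideal.span {PowerSeries.X - PowerSeries.C (p : ℤ_[p])}) 0 ⊔
        Ideal.span {PowerSeries.C (p : ℤ_[p])} ^ 2 := by
  rw [fittingIdeal_zero_quotient, fittingIdeal_zero_quotient]
  exact span_X_sup_sq_ne_span_X_sub_C_sup_sq

/-- And a fortiori the characteristic ideals differ: `(T) ≠ (T − p)` (the constant terms `0` and
`−p` are not associated). Iwasawa invariants do not determine characteristic ideals. [folklore] -/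
theorem span_X_ne_span_X_sub_C :
    Ideal.span {(PowerSeries.X : IwasawaAlgebra p)} ≠
      Ideal.span {PowerSeries.X - PowerSeries.C (p : ℤ_[p])} := by
  intro heq
  have hmem : (PowerSeries.X - PowerSeries.C (p : ℤ_[p]) : IwasawaAlgebra p) ∈
      Ideal.span {(PowerSeries.X : IwasawaAlgebra p)} := by
    rw [heq]; exact Ideal.mem_span_singleton_self _
  obtain ⟨u, hu⟩ := Ideal.mem_span_singleton'.mp hmem
  have h0 := congrArg PowerSeries.constantCoeff hu
  simp only [map_mul, PowerSeries.constantCoeff_X, mul_zero, map_sub,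
    PowerSeries.constantCoeff_C, zero_sub] at h0
  have hp : (p : ℤ_[p]) ≠ 0 := by exact_mod_cast (Fact.out : p.Prime).ne_zero
  exact hp (neg_eq_zero.mp h0.symm)

/-! ## §2. The repaired congruence limit, closed by Iwasawa invariants (memo §4, S5–S8) -/

/-- `μ(L) = 0` means `p ∤ L` in `Λ`. [folklore] -/
theorem not_C_dvd_of_mu_eq_zero {L : IwasawaAlgebra p} (hL : L ≠ 0) (hμ : mu L = 0) :
    ¬ PowerSeries.C (p : ℤ_[p]) ∣ L := by
  rw [← red_eq_zero_iff]
  have hpf : pfree L = L := by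
    have h := eq_C_pow_mu_mul_pfree L
    rw [hμ, pow_zero, map_one, one_mul] at h
    exact h.symm
  rw [← hpf]
  exact red_pfree_ne_zero hL

/-- **Peeling off `p` (memo S7).** If `μ(L) = 0` and `L ∣ p^a · g` in `Λ = ℤ_[p]⟦T⟧`, then `L ∣ g`
(`p` is a prime element of `Λ` not dividing `L`). [folklore] -/
theorem dvd_of_dvd_C_pow_mul_of_mu_eq_zero {L g : IwasawaAlgebra p} (hL : L ≠ 0) (hμ : mu L = 0)
    (a : ℕ) (h : L ∣ PowerSeries.C (p : ℤ_[p]) ^ a * g) : L ∣ g := by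
  induction a with
  | zero => simpa using h
  | succ n ih =>
    apply ih
    obtain ⟨k, hk⟩ := h
    -- `p ∣ L * k`, `p ∤ L`, so `p ∣ k`
    have hpdvd : PowerSeries.C (p : ℤ_[p]) ∣ L * k := ⟨PowerSeries.C (p : ℤ_[p]) ^ n * g, by
      rw [← hk]; ring⟩
    rcases (IwasawaAlgebra.prime_C p).dvd_or_dvd hpdvd with hpL | hpk
    · exact absurd hpL (not_C_dvd_of_mu_eq_zero hL hμ)
    · obtain ⟨k', rfl⟩ := hpk
      refine ⟨k', ?_⟩
      have hC : (PowerSeries.C (p : ℤ_[p]) : IwasawaAlgebra p) ≠ 0 := (IwasawaAlgebra.prime_C p).ne_zero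
      apply mul_left_cancel₀ hC
      calc PowerSeries.C (p : ℤ_[p]) * (PowerSeries.C (p : ℤ_[p]) ^ n * g)
          = PowerSeries.C (p : ℤ_[p]) ^ (n + 1) * g := by ring
        _ = L * (PowerSeries.C (p : ℤ_[p]) * k') := hk
        _ = PowerSeries.C (p : ℤ_[p]) * (L * k') := by ring

/-- **Closing by invariants (memo S8 = Greenberg–Vatsal p. 4 / Keller–Yin Thm `IMC` L1637–1640).**
If `L ∣ g`, `g ≠ 0`, `μ(g) ≤ μ(L)` and `λ(g) ≤ λ(L)` then `(g) = (L)` — one divisibility plus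
equality of Iwasawa invariants is equality of ideals. (Wrapper on the tree's
`X1.MuLambda.span_eq_span_iff_mu_le_and_lam_le`.) [cite: GreenbergVatsal2000, p. 4 (after Thm. (1.2))] -/
theorem span_eq_span_of_dvd_of_mu_le_of_lam_le {L g : IwasawaAlgebra p} (hg : g ≠ 0) (hdvd : L ∣ g)
    (hμ : mu g ≤ mu L) (hlam : lam g ≤ lam L) :
    Ideal.span ({g} : Set (IwasawaAlgebra p)) = Ideal.span {L} := by
  obtain ⟨h, hfac⟩ := hdvd
  have hL : L ≠ 0 := by rintro rfl; exact hg (by rw [hfac, zero_mul])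
  exact (span_eq_span_iff_mu_le_and_lam_le hL hg hfac).mpr ⟨hμ, hlam⟩

/-- **The repaired limit, ring form (memo S6–S8).** Let `g, L ∈ Λ = ℤ_[p]⟦T⟧` be nonzero with
`μ(g) = μ(L) = 0` and `λ(g) ≤ λ(L)` (Keller–Yin's Theorem D′: equal invariants, memo §3), and suppose
the ONE-SIDED congruences `p^a · (g) ⊆ (L) + (p)^m` hold for every `m ≥ 1` with `a` fixed (memo S6:
what the Fitting-ideal comparison delivers when finite submodules are allowed). Then `(g) = (L)`.
Proof: Krull (`⋂ₘ ((L) + (p)^m) = (L)`, tree `iInf_sup_pow_eq_self`) gives `L ∣ p^a g`, peeling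
gives `L ∣ g`, and the invariants close. [cite: Skinner2016PacificMC, §3.1 (p. 192) (shape of the limit)]
[cite: GreenbergVatsal2000, p. 4 (closing by invariants)] -/
theorem span_eq_span_of_forall_pow_mul_span_le_sup {g L : IwasawaAlgebra p} (hg : g ≠ 0)
    (hL : L ≠ 0) (hμg : mu g = 0) (hμL : mu L = 0) (hlam : lam g ≤ lam L) (a : ℕ)
    (h : ∀ m : ℕ, 1 ≤ m →
      Ideal.span {PowerSeries.C (p : ℤ_[p])} ^ a * Ideal.span {g} ≤
        Ideal.span {L} ⊔ Ideal.span {PowerSeries.C (p : ℤ_[p])} ^ m) :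
    Ideal.span ({g} : Set (IwasawaAlgebra p)) = Ideal.span {L} := by
  set I : Ideal (IwasawaAlgebra p) := Ideal.span {PowerSeries.C (p : ℤ_[p])} with hI
  -- Krull: the one-sided congruences for all `m` give `p^a (g) ≤ (L)`
  have hle : I ^ a * Ideal.span {g} ≤ Ideal.span {L} := by
    rw [← iInf_sup_pow_eq_self I (Ideal.span {L}) (span_C_p_le_jacobson p)]
    refine le_iInf fun m => ?_
    rcases Nat.eq_zero_or_pos m with rfl | hm
    · rw [pow_zero, Ideal.one_eq_top, sup_top_eq]; exact le_top
    · exact h m hm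
  have hmem : PowerSeries.C (p : ℤ_[p]) ^ a * g ∈ Ideal.span {L} := by
    apply hle
    rw [hI, Ideal.span_singleton_pow]
    exact Ideal.mul_mem_mul (Ideal.mem_span_singleton_self _) (Ideal.mem_span_singleton_self _)
  have hdvd : L ∣ g :=
    dvd_of_dvd_C_pow_mul_of_mu_eq_zero hL hμL a (Ideal.mem_span_singleton.mp hmem)
  exact span_eq_span_of_dvd_of_mu_le_of_lam_le hg hdvd (by rw [hμg, hμL]) hlam

/-- **The repaired congruence limit, module form (memo §4 Theorem D″ modulo its Selmer-theoretic
inputs; compare `X11b.CongruenceLimit.isTorsion_and_charIdeal_eq_of_congruences`).** Over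
`Λ = ℤ_[p]⟦T⟧`: `M` a finite `Λ`-module (`𝔛^S_f`) with `char(M) = (g)`, `g ≠ 0`, and
`p^a·(g) ≤ Fitt₀(M)` (`hfitt`: `M_free` has `pd ≤ 1` so `Fitt₀(M_free) = (g)`, and
`Fitt₀(M_fin)·Fitt₀(M_free) ≤ Fitt₀(M)` with `Fitt₀(M_fin) ⊇ 𝔪^{a}` — the FIXED module's finite
part); for each `m ≥ 1` a finite module `N_m` (`𝔛^S_{f_m}`) with a `Λ`-isomorphism `M/p^m ≅ N_m/p^m`
(`e`: lattice congruence (α) + exact control, memo S1–S4) and ONLY the one-sided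
`Fitt₀(N_m) ≤ (L_m)` (`hN`: `Fitt₀ ⊆ char = (L_m)` — NO hypothesis on finite submodules of `N_m`,
which is Keller–Yin's declared obstruction L259/L303), the congruences `(L_m) + (p)^m = (L) + (p)^m`
(`hc`: (b), two-variable `L`-function), and the invariants `μ(g) = μ(L) = 0`, `λ(g) ≤ λ(L)` (Theorem
D′ = what Keller–Yin §5 proves). THEN `char(M) = (L)`. Pure algebra; CONDITIONAL on nothing; the
inputs are NOT constructed here. [cite: Skinner2016PacificMC, §3.1 (p. 192)]
[cite: Castella2018Erratum, proof of Thm. 1.1 (p. 4)] (Keller–Yin Thm 5.1.3 via memo Thm D″, input (α)) [claim: KellerYin2024, status: under-review] -/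
theorem charIdeal_eq_span_of_oneSided_congruences
    {M : Type*} [AddCommGroup M] [Module (IwasawaAlgebra p) M] [Module.Finite (IwasawaAlgebra p) M]
    (N : ℕ → Type*) [∀ m, AddCommGroup (N m)] [∀ m, Module (IwasawaAlgebra p) (N m)]
    [∀ m, Module.Finite (IwasawaAlgebra p) (N m)]
    {g L : IwasawaAlgebra p} (hg : g ≠ 0) (hL : L ≠ 0)
    (hchar : charIdeal (IwasawaAlgebra p) M = Ideal.span {g})
    (a : ℕ) (hfitt : Ideal.span {PowerSeries.C (p : ℤ_[p])} ^ a * Ideal.span {g} ≤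
      Module.fittingIdeal (IwasawaAlgebra p) M 0)
    (Lm : ℕ → IwasawaAlgebra p)
    (e : ∀ m : ℕ, 1 ≤ m →
      ((M ⧸ ((Ideal.span {(PowerSeries.C (p : ℤ_[p]) : IwasawaAlgebra p)}) ^ m •
          (⊤ : Submodule (IwasawaAlgebra p) M))) ≃ₗ[IwasawaAlgebra p]
        (N m ⧸ ((Ideal.span {(PowerSeries.C (p : ℤ_[p]) : IwasawaAlgebra p)}) ^ m •
          (⊤ : Submodule (IwasawaAlgebra p) (N m))))))
    (hN : ∀ m : ℕ, 1 ≤ m → Module.fittingIdeal (IwasawaAlgebra p) (N m) 0 ≤ Ideal.span {Lm m})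
    (hc : ∀ m : ℕ, 1 ≤ m →
      Ideal.span {Lm m} ⊔ (Ideal.span {(PowerSeries.C (p : ℤ_[p]) : IwasawaAlgebra p)}) ^ m =
        Ideal.span {L} ⊔ (Ideal.span {(PowerSeries.C (p : ℤ_[p]) : IwasawaAlgebra p)}) ^ m)
    (hμg : mu g = 0) (hμL : mu L = 0) (hlam : lam g ≤ lam L) :
    charIdeal (IwasawaAlgebra p) M = Ideal.span {L} := by
  rw [hchar]
  refine span_eq_span_of_forall_pow_mul_span_le_sup hg hL hμg hμL hlam a fun m hm => ?_
  set I : Ideal (IwasawaAlgebra p) := Ideal.span {PowerSeries.C (p : ℤ_[p])}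
  calc I ^ a * Ideal.span {g}
      ≤ Module.fittingIdeal (IwasawaAlgebra p) M 0 := hfitt
    _ ≤ Module.fittingIdeal (IwasawaAlgebra p) M 0 ⊔ I ^ m := le_sup_left
    _ = Module.fittingIdeal (IwasawaAlgebra p) (N m) 0 ⊔ I ^ m :=
        fittingIdeal_sup_eq_of_quotEquiv (I ^ m) (e m hm) 0
    _ ≤ Ideal.span {Lm m} ⊔ I ^ m := sup_le_sup_right (hN m hm) _
    _ = Ideal.span {L} ⊔ I ^ m := hc m hm

/-! ## §3. The per-pair certificate `λ(𝓛_f) = 0` (memo §3 (ii)): Theorem D′ alone closes the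
IMC atom when the `p`-adic `L`-function has unit constant term -/

/-- A power series over `ℤ_[p]` with unit constant term has `μ = 0` and `λ = 0` (it is a unit of
`Λ`; Washington §7.1). [cite: Washington1997, §7.1] -/
theorem mu_eq_zero_and_lam_eq_zero_of_isUnit_constantCoeff {L : IwasawaAlgebra p}
    (hL : IsUnit (PowerSeries.constantCoeff L)) : mu L = 0 ∧ lam L = 0 := by
  have hu : IsUnit L := PowerSeries.isUnit_iff_constantCoeff.mpr hL
  exact ⟨((isUnit_iff_mu_eq_zero_and_lam_eq_zero L).mp hu).2.1,
    ((isUnit_iff_mu_eq_zero_and_lam_eq_zero L).mp hu).2.2⟩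

/-- **Theorem D′ + `λ_an = 0` ⟹ the characteristic power series is a unit (memo §3 (ii)).** If
`L(0)` is a `p`-adic unit (`ord_p 𝓛_f(𝟙) = 0`; via the (BDP) link this is `ord_p log_ω P_K = 1`)
and `g` has the same Iwasawa invariants as `L` (Keller–Yin's Theorem D′: `μ(𝔛_f) = μ(𝓛_f)`,
`λ(𝔛_f) = λ(𝓛_f)`), then `g(0)` is a unit too — i.e. `ord_p g(0) = 0 = ord_p L(0)`, which is the
tree's shadow atom `X11b.LambdaAdicShadow.IMCAtTrivialChar` at such a pair, with NO appeal to the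
disputed step of Keller–Yin §5. Pure algebra. (Keller–Yin Thm 5.1.3, invariants form, memo §3) [claim: KellerYin2024, status: under-review] -/
theorem isUnit_constantCoeff_of_invariants_eq {g L : IwasawaAlgebra p} (hg : g ≠ 0)
    (hL : IsUnit (PowerSeries.constantCoeff L)) (hμ : mu g = mu L) (hlam : lam g = lam L) :
    IsUnit (PowerSeries.constantCoeff g) := by
  obtain ⟨hμL, hlamL⟩ := mu_eq_zero_and_lam_eq_zero_of_isUnit_constantCoeff hL
  have hu : IsUnit g :=
    (isUnit_iff_mu_eq_zero_and_lam_eq_zero g).mpr ⟨hg, hμ.trans hμL, hlam.trans hlamL⟩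
  exact PowerSeries.isUnit_iff_constantCoeff.mp hu

/-- Module form: if `char(M) = (g)` with `g ≠ 0`, `L(0)` is a unit and the invariants of `g` and
`L` agree (Theorem D′), then `char(M) = Λ = (L)` — the main-conjecture identity holds at such a
pair because both sides are the unit ideal (`M` is pseudo-null). [claim: KellerYin2024, status: under-review] -/
theorem charIdeal_eq_top_and_eq_span_of_invariants_eq
    {M : Type*} [AddCommGroup M] [Module (IwasawaAlgebra p) M]
    {g L : IwasawaAlgebra p} (hg : g ≠ 0) (hchar : charIdeal (IwasawaAlgebra p) M = Ideal.span {g})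
    (hL : IsUnit (PowerSeries.constantCoeff L)) (hμ : mu g = mu L) (hlam : lam g = lam L) :
    charIdeal (IwasawaAlgebra p) M = ⊤ ∧ charIdeal (IwasawaAlgebra p) M = Ideal.span {L} := by
  have hgu : IsUnit g :=
    PowerSeries.isUnit_iff_constantCoeff.mpr (isUnit_constantCoeff_of_invariants_eq hg hL hμ hlam)
  have hLu : IsUnit L := PowerSeries.isUnit_iff_constantCoeff.mpr hL
  rw [hchar, Ideal.span_singleton_eq_top.mpr hgu, Ideal.span_singleton_eq_top.mpr hLu]
  exact ⟨rfl, rfl⟩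

end Summit.BirchSwinnertonDyer.Rank1Residual.X2.KellerYinFreePartGap

end
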